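import Summits.Ventures.PercRepro.RankLevelSetRuleQCell

/-!
# PercRepro — RULE Q AT THE TIGHT LAYER: THE CELL INEQUALITIES `RhatCell q k` BY KERNEL EVALUATION (RankLevelSetRuleQCellEvalQ1B; night-1, gen 14)

Each theorem `rhatCell_q_k : RhatCell q k` (`∀ m ≤ q, Φ(q+k, q) ≤ R̂(q, k, m)`, RankLevelSetRuleQCell) is discharged by
`interval_cases m` and `norm_num` on the unfolded binomial sums (`Nat.choose` by its recursion; the
`Finset.Ioo`-sums as `Finset.range`-sums via `sum_Ioo_nat`). No `native_decide`, no `decide` on the rationals. With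
`hallUp_of_ncard_eq_of_rhatCell` each cell gives the UP form of C-044 at the tight layer `#E = (q+k) + q` of the cell
`(q+k, q)` for every finite matroid; the DOWN form is `hallDown_of_ncard_eq`. Cells: (1,22).
Axioms: standard.
-/

namespace PercRepro

open Finset

/-- `Φ(23, 1) ≤ R̂(1, 22, 0)` (the cell `(23, 1)` at `#P = 0`), by kernel evaluation. -/
theorem rhatCell_1_22_0 : phiK (1 + 22) 1 ≤ rhat 1 22 0 := by
  simp only [rhat, phiK, mhat, sum_Ioo_nat]
  norm_num [Finset.sum_range_succ, Nat.choose, Nat.min_def]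

/-- `Φ(23, 1) ≤ R̂(1, 22, 1)` (the cell `(23, 1)` at `#P = 1`), by kernel evaluation. -/
theorem rhatCell_1_22_1 : phiK (1 + 22) 1 ≤ rhat 1 22 1 := by
  simp only [rhat, phiK, mhat, sum_Ioo_nat]
  norm_num [Finset.sum_range_succ, Nat.choose, Nat.min_def]

/-- The cell `(23, 1)` (`q = 1`, `k = 22`): `Φ(23, 1) ≤ R̂(1, 22, m)` for every `m ≤ 1`. -/
theorem rhatCell_1_22 : RhatCell 1 22 := by
  intro m hm
  interval_cases m
  · exact rhatCell_1_22_0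
  · exact rhatCell_1_22_1

end PercRepro
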